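import Mathlib
import Literature.AlgebraicGeometry.Resolution.CoordinateBlowupChart
import Literature.AlgebraicGeometry.Hironaka2017.Lib.ToricKernel
import Summits.ResolutionOfSingularities.ResolutionOfSingularities.Theorems.EquisingularLiftEquisingularLiftNatGoodAtOfFlatModel

/-!
# Sketch — res-L1-w45b-idea-1 g15 (crux-ideate on stmt-ResolutionOfSingularities-20148, EL♮(3) B-residues)

OURS · L1 W4.5(b) · counted 0 · AI-written first lemmas of two crux idea cards (`toric-towers`, `nested-sections`);
nothing of [Hironaka2017] asserted; no summit statement is proved here.  Sorries only inside `stub_*` / `conj_*`.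
-/

noncomputable section

set_option linter.dupNamespace false

open MvPolynomial

namespace Summit.ResolutionOfSingularities.ResolutionOfSingularities.Cruxes.EquisingularLiftNatThree.Ideas.IdeaOne

/-! ## Card `toric-towers` — (1) the E1 dictionary in a cone chart -/

section Dictionary

variable {k : Type*} [Field k] {σ τ : Type*}

/-- Value of the support function of `Γ₊(f)` at the ray `j` of the chart cone with column matrix `col`
(`col i = (⟨ρ_j, e_i⟩)_j`, so `Finsupp.weight col d = (⟨ρ_j, d⟩)_j`): `h j = min_{d ∈ supp f} ⟨ρ_j, d⟩`. [OURS] -/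
def rayMin (col : σ → (τ →₀ ℕ)) (f : MvPolynomial σ k) (hf : f.support.Nonempty) (j : τ) : ℕ :=
  f.support.inf' hf (fun d => Finsupp.weight col d j)

/-- `h` is LINEAR on the face spanned by the rays `T` iff ONE exponent of `f` realises the minimum at every ray of `T`
(a common minimising vertex of the Newton polyhedron). Its negation is «E1-legal / bad cone». [OURS] -/
def LinearOnFace (col : σ → (τ →₀ ℕ)) (f : MvPolynomial σ k) (hf : f.support.Nonempty) (T : Set τ) : Prop :=
  ∃ d ∈ f.support, ∀ j ∈ T, Finsupp.weight col d j = rayMin col f hf j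

/-- **E1 DICTIONARY** (first checkable statement of the line `toric-towers`): in the chart of a regular cone the strict
transform of `V(f)` is `toricMap col f / y^h` (`h = rayMin`), and the orbit closure `V(y_j : j ∈ T)` lies INSIDE it iff the
support function is NOT linear on the face `T`.  (`hcol`: the cone is simplicial of full rank, so no two exponents collide and no
cancellation occurs.)  Proof route: `toricMap_monomial` + `MvPolynomial.mem_ideal_span_X_image` + exactness of the division. [OURS] -/
theorem stub_e1_iff_not_linearOnFace [Fintype τ] [DecidableEq τ] (col : σ → (τ →₀ ℕ)) (f : MvPolynomial σ k)
    (hf : f.support.Nonempty) (hcol : Function.Injective (Finsupp.weight col : (σ →₀ ℕ) → (τ →₀ ℕ))) (T : Set τ) :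
    MvPolynomial.divMonomial (Literature.AlgebraicGeometry.Hironaka2017.Lib.ToricKernel.toricMap col f)
        (Finsupp.equivFunOnFinite.symm (rayMin col f hf)) ∈ Ideal.span (X '' T) ↔
      ¬ LinearOnFace col f hf T := by
  sorry

end Dictionary

/-! ## Card `toric-towers` — (2) the ℤ-lift principle in a chart: the toric tower is a CONSTANT family over `O` -/

section BaseChange

variable {S T : Type*} [CommRing S] [CommRing T] {σ : Type*} (A : Set σ) (i₀ : σ)

open Literature.AlgebraicGeometry.Resolution in
/-- The strict coordinate transform `coordBlowupSubst f / X_{i₀}^e` commutes with every base change `φ : S → T` — in particular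
with the residue map `W(k) ↠ k`: the same monomial recipe gives the char-0 and the char-`p` strict transform, so a chain of
blow-ups of `ℙⁿ_O` in coordinate (torus-invariant) centres specialises chart by chart to the same chain over `k`. [OURS] -/
theorem stub_strictCoordTransform_map (φ : S →+* T) (f : MvPolynomial σ S) (e : ℕ) :
    MvPolynomial.map φ (MvPolynomial.divMonomial (coordBlowupSubst S A i₀ f) (Finsupp.single i₀ e)) =
      MvPolynomial.divMonomial (coordBlowupSubst T A i₀ (MvPolynomial.map φ f)) (Finsupp.single i₀ e) := by
  sorry

/-- … and when the reduction kills no vertex (same support — e.g. `f` = the Teichmüller lift of `f̄`), the order of `f` along the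
centre `V(X_i : i ∈ B)`, hence the exponent `e` of the exact division, is the same upstairs and downstairs. [OURS] -/
theorem ordAlong_map (φ : S →+* T) (f : MvPolynomial σ S) (hsupp : (MvPolynomial.map φ f).support = f.support)
    (B : Finset σ) :
    (MvPolynomial.map φ f).support.image (fun d => ∑ i ∈ B, d i) = f.support.image (fun d => ∑ i ∈ B, d i) := by
  rw [hsupp]

end BaseChange

/-! ## Card `toric-towers` — (3) the Transfer statement C⁺ = FANGAME₃ (pure combinatorics; OPEN, OURS) -/

section FanGame

/-- Rays: lattice vectors of `ℤ³` (primitivity not enforced by the type). -/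
abbrev Ray := Fin 3 → ℤ

/-- `⟨ρ, m⟩`. -/
def pair (ρ : Ray) (m : Fin 3 → ℕ) : ℤ := ∑ i, ρ i * (m i : ℤ)

/-- «BAD» = E1-legal: the support function of the polyhedron with vertex set `V` is NOT linear on the cone spanned by `τ`
(no vertex minimises all rays of `τ` simultaneously). -/
def Bad (V : Finset (Fin 3 → ℕ)) (τ : Finset Ray) : Prop :=
  ¬ ∃ m ∈ V, ∀ ρ ∈ τ, ∀ m' ∈ V, pair ρ m ≤ pair ρ m'

/-- Barycentric star subdivision of a fan (recorded by its maximal cones, each a finite set of rays) at the face `τ`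
(= blow-up of the smooth invariant centre `V(τ)`; the only stars that keep all cones unimodular). -/
def star (F : Finset (Finset Ray)) (τ : Finset Ray) : Finset (Finset Ray) :=
  (F.filter (fun σ => ¬ τ ⊆ σ)) ∪
    (F.filter (fun σ => τ ⊆ σ)).biUnion (fun σ => τ.image (fun t => insert (∑ ρ ∈ τ, ρ) (σ.erase t)))

/-- Positions reachable from `F` by E1-LEGAL smooth toric blow-ups: star a face `τ` (2 or 3 rays) of a current cone on which
the support function is non-linear. -/
inductive Reach (V : Finset (Fin 3 → ℕ)) : Finset (Finset Ray) → Finset (Finset Ray) → Prop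
  | refl (F : Finset (Finset Ray)) : Reach V F F
  | step (F F' : Finset (Finset Ray)) (τ σ : Finset Ray) :
      Reach V F F' → σ ∈ F' → τ ⊆ σ → 2 ≤ τ.card → Bad V τ → Reach V F (star F' τ)

/-- The positive orthant (one chart `𝔸³`; for `ℙ³` take the four orthants of its fan). -/
def orthant : Finset (Finset Ray) := {{Pi.single 0 1, Pi.single 1 1, Pi.single 2 1}}

/-- **FANGAME₃** (the card's Transfer `C⁺`): some E1-legal sequence of smooth toric blow-ups linearises the support function
on every cone (⇒ the strict transform of a Newton-nondegenerate surface is regular and misses all bad strata).  Binomial case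
(`V.card = 2`, one wall) = Bierstone–Milman 2006 Thm 5.3; the adversarial cousin is Hironaka's polyhedra game (Spivakovsky 1983). -/
def FanGameWins (V : Finset (Fin 3 → ℕ)) : Prop :=
  ∃ F, Reach V orthant F ∧ ∀ σ ∈ F, ¬ Bad V σ

/-- OPEN (OURS). Phase 1 («every vertex of the corner locus becomes a ray, legally») is proved on paper in the card. -/
theorem conj_fanGame₃ (V : Finset (Fin 3 → ℕ)) (hV : V.Nonempty) : FanGameWins V := by
  sorry

end FanGame

/-! ## Card `nested-sections` — first lemma: the point-step section INSIDE the stratum of the members through `y` -/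

section NestedSections

open CategoryTheory AlgebraicGeometry IsLocalRing
open Literature.AlgebraicGeometry.Resolution

/-- **NESTED HENSEL SECTION.** If the stratum `ι : W ↪ X` (scheme-theoretic intersection of the `O`-models of the retained
members through `y`) is flat over `O`, regular at `y` and has regular special fibre at `y` (relative snc bookkeeping), then the
point-step section through `y` can be chosen INSIDE `W` — so every member `V(𝓕) ⊇ W` contains the centre and its strict
transform is `Bl_s V(𝓕)` with IRREDUCIBLE trace `Bl_y F`.  Immediate from the tree's
`Sections.exists_section_of_model_of_isRegularLocalRing` applied to `W`; recorded as the line's first statement. [OURS] -/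
theorem stub_nested_section (O : Type) [CommRing O] [IsDomain O] [IsDiscreteValuationRing O]
    [IsAdicComplete (maximalIdeal O) O] [IsAlgClosed (ResidueField O)] (k : Type) [Field k]
    (θ : O →+* k) (hθ : Function.Surjective θ) (X W F : Scheme.{0}) (r : X ⟶ Spec (.of O)) (ι : W ⟶ X)
    [IsClosedImmersion ι] [Flat (ι ≫ r)] [IsSeparated (ι ≫ r)] [LocallyOfFinitePresentation (ι ≫ r)]
    (j : F ⟶ W) (t : F ⟶ Spec (.of k)) (hsq : IsPullback j t (ι ≫ r) (Spec.map (CommRingCat.ofHom θ))) (x : F)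
    (hxcl : IsClosed ({x} : Set F)) (hreg : IsRegularLocalRing (W.presheaf.stalk (j x)))
    (hx : IsRegularLocalRing (F.presheaf.stalk x)) :
    ∃ s : Spec (.of O) ⟶ X, s ≫ r = 𝟙 _ ∧ s (closedPoint O) = ι (j x) ∧
      Scheme.IsRegular s.ker.subscheme ∧ Set.range s.base ⊆ Set.range ι.base := by
  sorry

end NestedSections

end Summit.ResolutionOfSingularities.ResolutionOfSingularities.Cruxes.EquisingularLiftNatThree.Ideas.IdeaOne

end
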